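import Summits.BirchSwinnertonDyer.BirchSwinnertonDyer.Theses.EisensteinPrimes
import Summits.BirchSwinnertonDyer.Rank1Residual.X2.SplitCellCClassIntPNew
import Summits.BirchSwinnertonDyer.Rank1Residual.X2.NonsplitCellCClassInt
import HarnessLib

/-!
# Crux 4 `BSDpOnCellC` from line b1's stubs with the VALUE input (c2, BOTH signs) needed ONLY AT `p = 3`
# — at `p ≥ 5` it is PUBLISHED at either sign (Castella JIMJ 17 (2018) Thms. 2.10–2.11 in BDP 2013's
# display, `a_p` symbolic, + k5-c4's kernel rescaling `X2.continuousDisplay_pNew_of_bdpDisplay`) (cell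
# `bsd-eis`, seat `bsd-eis-cgshw` g9; route `EisensteinPrimes`, crux 4 = stmt-BirchSwinnertonDyer-19034,
# line b1 skeleton v7; RULINGS L11 (O2) / L12 (iii) / L15 + AMENDMENT; the symmetric twin of k5-c4's
# `Theorems/EisensteinPrimesBSDpOnCellCValueFromPrint.lean` p437638)

HONEST FRAMING (cell `bsd-eis`, run/shared/lean/pub/bsd-eis/): theorems only; nothing booked; X2 stays
CONSTRUCTION-SHAPED; no label or count moves; BSD is not proved by any of this — a closed crux 4 would
close the B11 leaf of rung K5 only.

k5-c4's `bsdpOnCellC_of_stubs_of_pNewValue` (p437638) composes line b1's five stubs into the route decl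
with the NON-split conjunct of `stub_c2` weakened to `p = 3` (at a non-split `p ≥ 5` the value half is
the published fact `Castella2018Exceptional.thm210_thm211_bdpDisplay_pNew` through
`X2.bsdp_of_cellC_of_not_split_of_pNewValue_of_imcInt`, p436961). The fact and the kernel rescaling are
SIGN-FREE, so the SPLIT conjunct weakens the same way through cgshw g9's
`X2.bsdp_of_cellC_of_split_of_pNewValue_of_imcInt_of_ctlOrSwitch` (`X2/SplitCellCClassIntPNew.lean`,
p438196). This file proves the SYMMETRIC composition = skeleton v7's `BSDpOnCellC_of`:

* **`bsdpOnCellC_of_stubs_of_pNewValue_bothSigns`** — `BSDpOnCellC` from: the 23 published facts + the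
  24th (`thm210_thm211_bdpDisplay_pNew`); c2♭ `NonsplitBDPValueOnTreeInt W p` ONLY at `p = 3` (2 552 +
  2 830 non-split B11 cells @3); c2s♭ `SplitBDPValueOnTreeInt W p` ONLY at `p = 3` (7 429 NotGV + the GV
  split B11 cells @3); `stub_c3` (c3♭ ∧ c3s♭, Keller–Yin Thm. D shape, PRE); `stub_ctlOrSwitch` (split:
  CTL-split ∨ étale switch per pair); `MazurMCOnCellB` (crux 3) verbatim. Case split `5 ≤ p` / `p = 3`
  (the only odd prime below `5`) × sign: `p ≥ 5` → the two `…_pNewValue_…` class theorems (value half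
  FROM PRINT); `p = 3` split → the optimal-curve passage + «CTL ∨ switch» + the pointwise
  `X2.bsdp_of_cellC_of_split_of_manin_of_intResiduals` (p432213) at that prime with the c2s♭ input;
  `p = 3` non-split → as in p437638 (`X2.bsdp_of_cellC_of_not_split_of_manin_of_intResiduals`).

So in stub currency: crux 4 ⇐ PUB(24) ∧ [c2♭ @ p = 3 ∧ ¬split] ∧ [c2s♭ @ p = 3 ∧ split] ∧ c3 ∧
ctlOrSwitch ∧ crux 3 — NO value input at any `p ≥ 5`. CONDITIONAL on every listed binder; nothing
booked; no label change.

References: [Castella2018Exceptional] Thms. 2.10–2.11, Prop. 2.7; [BertoliniDarmonPrasanna2013] Thm.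
4.6, (5.1.11), Thm. 5.5, §5.2; [Castella2018] Thm. 2.3, Thm. 3.2; [Hsieh2014] Thm. 1; [KellerYin2024]
Thm. D (PRE); [CastellaEtAl2021] Thm. 5.3.1; [Mazur1978] Cor. 4.1; [MilneADT2006] I.7.3; [Miller2011LMS] Def. 1.1.
-/

set_option autoImplicit false
set_option linter.dupNamespace false

noncomputable section

open scoped Classical MatrixGroups ModularForm

open CongruenceSubgroup WeierstrassCurve NumberField IsDedekindDomain Field PowerSeries
  Literature.NumberTheory.EllipticCurves Literature.NumberTheory.EllipticCurves.GreenbergSelmer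
  Literature.NumberTheory.EllipticCurves.ModularForms Literature.NumberTheory.QuadraticFields
  Literature.NumberTheory.EllipticCurves.Rank1Residual
  Literature.NumberTheory.EllipticCurves.Rank1Residual.Typed
  Literature.NumberTheory.EllipticCurves.KrizLi2019
  Literature.NumberTheory.EllipticCurves.GreenbergVatsal2000
  Literature.NumberTheory.EllipticCurves.Wuthrich2014
  Literature.NumberTheory.EllipticCurves.SteinWuthrich2013
  Literature.NumberTheory.EllipticCurves.Castella2018Exceptional
  Literature.NumberTheory.GaloisRepresentations Literature.NumberTheory.GaloisCohomology
  Literature.NumberTheory.Automorphic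
  Summit.BirchSwinnertonDyer.Rank1Residual.X11b.AcSelmer
  Summit.BirchSwinnertonDyer.Rank1Residual.X11b.Halves
  Summit.BirchSwinnertonDyer.Rank1Residual.X11b
  Summit.BirchSwinnertonDyer.Rank1Residual.X2

namespace Summit.BirchSwinnertonDyer.BirchSwinnertonDyer.Theorems

/-- **Crux 4 `BSDpOnCellC` from line b1's five stubs with the value input (either sign) ONLY AT `p = 3`.**
Hypotheses: the 23 published facts of `stub_publishedFacts` (as stated there) and the 24th,
`thm210_thm211_bdpDisplay_pNew` ([cas-split] Thms. 2.10–2.11 in BDP's display, `a_p` symbolic);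
`h2three` = c2♭ at the non-split pairs with `p = 3` ONLY; `h2sthree` = c2s♭ at the split pairs with
`p = 3` ONLY; `h3` = `stub_c3` verbatim; `hctl` = `stub_ctlOrSwitch` verbatim; `hMCB` = the route decl
`MazurMCOnCellB` (crux 3) verbatim. Conclusion: the route decl `BSDpOnCellC` (= `X2.TargetC`) BY NAME.
Proof: `5 ≤ p` split → `X2.bsdp_of_cellC_of_split_of_pNewValue_of_imcInt_of_ctlOrSwitch` (cgshw g9,
p438196); `5 ≤ p` non-split → `X2.bsdp_of_cellC_of_not_split_of_pNewValue_of_imcInt` (k5-c4, p436961);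
otherwise `p = 3` (`p` an odd prime): split → the Manin condition moved to the optimal curve
(`X2.bsdp_of_cellC_of_forall_isIsogenous`; the split type is isogeny-invariant at a multiplicative prime),
case on «CTL ∨ switch» there, `X2.bsdp_of_cellC_of_split_of_manin_of_intResiduals` at the optimal curve
or at the switched curve (CTL the THEOREM `X2.splitControlOnTree_of_cellC_of_noPadicPTorsion`, back by
Cassels) with `h2sthree`; non-split → `X2.bsdp_of_cellC_of_not_split_of_manin_of_intResiduals` with
`h2three`, as in p437638. CONDITIONAL on every listed binder; nothing booked; X2 CONSTRUCTION-SHAPED; no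
label change. [cite: Castella2018Exceptional, Thm. 2.10 and Thm. 2.11 (arXiv:1507.04260 pp. 13–14)]
[cite: Hsieh2014, Thm. 1 (arXiv:1112.1580 pp. 3–4)] [claim: KellerYin2024, status: under-review]
[cite: CastellaEtAl2021, Thm. 5.3.1] [cite: Mazur1978, Cor. 4.1] [cite: MilneADT2006, Thm. I.7.3]
[cite: Castella2018, Thm. 2.3 (arXiv:1704.06608 p. 5)] [cite: Miller2011LMS, Def. 1.1] -/
theorem bsdpOnCellC_of_stubs_of_pNewValue_bothSigns
    (hPub : lambdaMu_multiplicative_of_gvPar ∧ thm16_charIdeal_dvd_multiplicative_of_reducible ∧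
      thm61_splitMultiplicative ∧ thm61_nonsplitMultiplicative ∧
      exists_isSplitMultCanonical ∧ exists_isMultCanonical ∧ nonempty_modularParametrizationData ∧
      (∀ (W : WeierstrassCurve ℚ) [W.IsElliptic] [W.IsGloballyMinimal] (p : ℕ) [Fact p.Prime],
        greenberg_stevens (W := W) (p := p)) ∧
      exists_isNewformOf ∧
      (∀ (K : Type) [Field K] [NumberField K], poitouTate_selmerStructure_duality K) ∧
      (∀ (K : Type) [Field K] [NumberField K], poitouTate_sha_tateDual K) ∧
      (∀ (K : Type) [Field K] [NumberField K] (v : HeightOneSpectrum (𝓞 K)),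
        localEulerPoincareCharacteristic (v.adicCompletion K)) ∧
      fieldCdLE_two_of_numberField ∧
      (∀ (K : Type) [Field K] [NumberField K] (p : ℕ) [Fact p.Prime],
        ZpExtension.decomp_not_le_kerSubgroup_of_isAnticyclotomic K p) ∧
      hsieh2014_exists_anticyclotomicPAdicLFunction ∧
      (∀ (N : ℕ) [NeZero N] (W : WeierstrassCurve ℚ) (K : Type) [Field K] [NumberField K],
        gross_zagier N W K) ∧
      (∀ (N : ℕ) [NeZero N] (W : WeierstrassCurve ℚ) (K : Type) [Field K] [NumberField K],
        kolyvagin N W K) ∧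
      (∀ (N : ℕ) [NeZero N] (W : WeierstrassCurve ℚ) (K : Type) [Field K] [NumberField K],
        heegnerPointComplex_mem_range_map N W K) ∧
      rank_eq_analyticRank_of_analyticRank_le_one ∧ HoffsteinLuo1997_exists_twist_L_one_ne_zero ∧
      edixhoven_optimalManinConstant_integral ∧ mazur_not_dvd_maninConstant_of_odd ∧
      bsdRHS_eq_of_isIsogenous)
    (hCS : thm210_thm211_bdpDisplay_pNew)
    (h2three : ∀ (W : WeierstrassCurve ℚ) [W.IsElliptic] [W.IsGloballyMinimal] (p : ℕ) [Fact p.Prime],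
      p = 3 → CellC W p → ¬ W.HasSplitMultiplicativeReductionAtPrime p → NonsplitBDPValueOnTreeInt W p)
    (h2sthree : ∀ (W : WeierstrassCurve ℚ) [W.IsElliptic] [W.IsGloballyMinimal] (p : ℕ) [Fact p.Prime],
      p = 3 → CellC W p → W.HasSplitMultiplicativeReductionAtPrime p → SplitBDPValueOnTreeInt W p)
    (h3 : (∀ (W : WeierstrassCurve ℚ) [W.IsElliptic] [W.IsGloballyMinimal] (p : ℕ) [Fact p.Prime],
        CellC W p → ¬ W.HasSplitMultiplicativeReductionAtPrime p → NonsplitIMCEqOnTreeInt W p) ∧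
      (∀ (W : WeierstrassCurve ℚ) [W.IsElliptic] [W.IsGloballyMinimal] (p : ℕ) [Fact p.Prime],
        CellC W p → W.HasSplitMultiplicativeReductionAtPrime p → SplitIMCEqOnTreeInt W p))
    (hctl : ∀ (W : WeierstrassCurve ℚ) [W.IsElliptic] [W.IsGloballyMinimal] (p : ℕ) [Fact p.Prime],
      CellC W p → W.HasSplitMultiplicativeReductionAtPrime p →
        SplitControlOnTree W p ∨
          ∃ (W' : WeierstrassCurve ℚ) (_ : W'.IsElliptic) (_ : W'.IsGloballyMinimal),
            IsIsogenous W W' ∧ HasPrimeToManinDatum W' p ∧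
              ∀ Q₀ : (W'.baseChange ℚ_[p]).toAffine.Point, p • Q₀ = 0 → Q₀ = 0)
    (hMCB : Summit.BirchSwinnertonDyer.BirchSwinnertonDyer.Theses.EisensteinPrimes.MazurMCOnCellB) :
    Summit.BirchSwinnertonDyer.BirchSwinnertonDyer.Theses.EisensteinPrimes.BSDpOnCellC := by
  obtain ⟨hGV, hWu, hJs, hJn, hHs, hHn, hpar, hGS, hnf, hPT, hPT2, hEP, hcd, hBr, hH, hGZ, hKo, hHP,
    hGZK, hHL, hEd, hMaz, hCassels⟩ := hPub
  obtain ⟨h3n, h3s⟩ := h3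
  unfold Summit.BirchSwinnertonDyer.BirchSwinnertonDyer.Theses.EisensteinPrimes.MazurMCOnCellB at hMCB
  unfold Summit.BirchSwinnertonDyer.BirchSwinnertonDyer.Theses.EisensteinPrimes.BSDpOnCellC
  intro W _ _ p _ hc
  have hmod : hasEntireLFunction_rat := hasEntireLFunction_rat_of_exists_isNewformOf hnf
  by_cases hp5 : 5 ≤ p
  · -- `p ≥ 5`: the value half is PUBLISHED at either sign
    by_cases hs : W.HasSplitMultiplicativeReductionAtPrime p
    · exact bsdp_of_cellC_of_split_of_pNewValue_of_imcInt_of_ctlOrSwitch hGV hWu hJs hJn hHs hHn hpar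
        hGS hnf hPT hPT2 hEP hcd hBr hH hCS hGZ hKo hHP hGZK hHL hEd hMaz hCassels h3s hctl
        (fun W' _ _ p' _ hB _ ↦ hMCB W' p' hB) W p hp5 hc hs
    · exact bsdp_of_cellC_of_not_split_of_pNewValue_of_imcInt hGV hWu hJs hJn hHs hHn hpar hGS hnf hPT
        hPT2 hEP hcd hBr hH hCS hGZ hKo hHP hGZK hHL hEd hMaz hCassels h3n
        (fun W' _ _ p' _ hB _ ↦ hMCB W' p' hB) W p hp5 hc hs
  · -- `p < 5`: `p` is an odd prime, so `p = 3`; the value half is the typed input at this prime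
    have hp : p.Prime := Fact.out
    have hp2 : p ≠ 2 := hc.2.1
    have hp3 : p = 3 := by
      have h2le := hp.two_le
      interval_cases p
      · exact absurd rfl hp2
      · rfl
      · exact absurd hp (by decide)
    refine bsdp_of_cellC_of_forall_isIsogenous hEd hMaz hCassels hpar hnf hGZK W p hc ?_
    intro W₀ _ _ hiso hc₀ hMan₀
    by_cases hs : W.HasSplitMultiplicativeReductionAtPrime p
    · -- split at `p = 3`: «CTL ∨ switch» at the optimal curve
      have hs₀ : W₀.HasSplitMultiplicativeReductionAtPrime p :=
        IsogenyQuotientLine.hasSplitMultiplicativeReductionAtPrime_of_isIsogenous hiso hs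
      rcases hctl W₀ p hc₀ hs₀ with hCTL₀ | ⟨W', _, _, hiso', hMan', h0'⟩
      · exact bsdp_of_cellC_of_split_of_manin_of_intResiduals W₀ p hGV hWu hJs hJn hHs hHn hpar hGS hnf
          hH hGZ hKo hHP hGZK hHL hc₀ hs₀ hMan₀ (h2sthree W₀ p hp3 hc₀ hs₀) (h3s W₀ p hc₀ hs₀) hCTL₀
          (fun W'' _ _ hB _ ↦ hMCB W'' p hB)
      · have hc' : CellC W' p := CellC.of_isIsogenous hiso' hc₀
        have hs' : W'.HasSplitMultiplicativeReductionAtPrime p :=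
          IsogenyQuotientLine.hasSplitMultiplicativeReductionAtPrime_of_isIsogenous hiso' hs₀
        have hCTL' : SplitControlOnTree W' p :=
          splitControlOnTree_of_cellC_of_noPadicPTorsion W' p hGZK hnf hPT hPT2 hEP hcd hBr hc' h0'
        have hb' : BSDp W' p :=
          bsdp_of_cellC_of_split_of_manin_of_intResiduals W' p hGV hWu hJs hJn hHs hHn hpar hGS hnf hH
            hGZ hKo hHP hGZK hHL hc' hs' hMan' (h2sthree W' p hp3 hc' hs') (h3s W' p hc' hs') hCTL'
            (fun W'' _ _ hB _ ↦ hMCB W'' p hB)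
        exact bsdp_of_isIsogenous_of_bsdp hCassels hGZK hmod W' W₀ hiso'.symm_of_charZero p
          (by rw [hc'.1]) hb'
    · -- non-split at `p = 3`
      have hns₀ : ¬ W₀.HasSplitMultiplicativeReductionAtPrime p := fun h ↦
        hs (IsogenyQuotientLine.hasSplitMultiplicativeReductionAtPrime_of_isIsogenous
          hiso.symm_of_charZero h)
      exact bsdp_of_cellC_of_not_split_of_manin_of_intResiduals W₀ p hGV hWu hJs hJn hHs hHn hpar hGS
        hnf hPT hPT2 hEP hcd hBr hH hGZ hKo hHP hGZK hHL hc₀ hns₀ hMan₀ (h2three W₀ p hp3 hc₀ hns₀)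
        (h3n W₀ p hc₀ hns₀) (fun W' _ _ hB _ ↦ hMCB W' p hB)

end Summit.BirchSwinnertonDyer.BirchSwinnertonDyer.Theorems

end
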